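import Summits.ResolutionOfSingularities.ResolutionOfSingularities.Theorems.WildDescent8
import HarnessLib

/-!
# WildDescent (9/13) — β-descent in a linear frame; §8 Chain: `slots`, `frameH`, `framePts`, Stage laws (L1 `slots_spec`, L2 `frameH_in`, L5 `alpha_le`)

Verbatim slice of the farm-checked monolith `WildDescent.lean` of cell `decomp-res`, seat `decomp-res-lens-5`, g36
(sha256 4ec0fa6f4f9efba7…); one namespace `Summit.ResolutionOfSingularities.ResolutionOfSingularities.Theorems.WildDescent` across the
slices, imports chained (laws L1–L7 and the mechanism: module docstring of slice 1; main theorems: slice 13/13).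
-/

open MvPolynomial Finset
open scoped BigOperators
open Literature.AlgebraicGeometry.Resolution
open Literature.AlgebraicGeometry.Resolution.Hauser2010
open Literature.AlgebraicGeometry.Resolution.PointBlowup
open Literature.AlgebraicGeometry.Resolution.HauserPerlega2024

namespace Summit.ResolutionOfSingularities.ResolutionOfSingularities.Theorems.WildDescent

/-! ## §8 THE WALL CHAIN (L1 slots, L2 frames along the chain, L5 isolation, L7 descent): the abstract
`wallChain_false`.  Data: the companion polynomials `G n`, the chart letters `j n`, centres `b n`, wall letters `k n`
(kept at move `n`), `l n` (lost), free letters `f n`, tangent data `c n`, `ℓ n`. -/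

section Chain

variable {K : Type} [Field K]

/-- **L1 · THE SLOTS.**  `slots n = (u, v)`: which wall letter is read as the first / second coordinate at stage `n`.
The kept wall keeps its slot; the exceptional letter `j n` inherits the slot of the LOST wall. DEFINITION (data).
[cite: CossartJannsenSaito2020, Def. 10.1 p.124] -/
def slots (u0 v0 : Fin 3) (l j : ℕ → Fin 3) : ℕ → Fin 3 × Fin 3
  | 0 => (u0, v0)
  | n + 1 => if (slots u0 v0 l j n).1 = l n then (j n, (slots u0 v0 l j n).2) else ((slots u0 v0 l j n).1, j n)

/-- Law L1 (slot recurrence, definitional): the new wall `j_n` inherits the slot of the lost wall `l_n`, the kept wall keeps its slot; Cossart–Jannsen–Saito 2020, (12.4). [cite: CossartJannsenSaito2020, (12.4) p.134] -/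
theorem slots_succ (u0 v0 : Fin 3) (l j : ℕ → Fin 3) (n : ℕ) :
    slots u0 v0 l j (n + 1) =
      if (slots u0 v0 l j n).1 = l n then (j n, (slots u0 v0 l j n).2) else ((slots u0 v0 l j n).1, j n) := rfl

/-- **L2 · THE FRAME POLYNOMIAL** `H_n = σ_{−η_n}(G_n)`, `η_n = (ℓ_k/ℓ_f) y_k + (ℓ_l/ℓ_f) y_l`. DEFINITION (data). [new] -/
noncomputable def frameH (G ℓ : ℕ → MvPolynomial (Fin 3) K) (f k l : ℕ → Fin 3) (n : ℕ) : MvPolynomial (Fin 3) K :=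
  WallFrames.zshear (f n)
    (-(C (coeff (Finsupp.single (k n) 1) (ℓ n) / coeff (Finsupp.single (f n) 1) (ℓ n)) * X (k n) +
       C (coeff (Finsupp.single (l n) 1) (ℓ n) / coeff (Finsupp.single (f n) 1) (ℓ n)) * X (l n))) (G n)

/-- **THE POINT SET** `Δ_n` of stage `n` in its slots. DEFINITION (data). [new] -/
noncomputable def framePts (s : ℕ) (G ℓ : ℕ → MvPolynomial (Fin 3) K) (f k l j : ℕ → Fin 3) (n : ℕ) : Finset (ℚ × ℚ) :=
  pts s (f n) (slots (k 0) (l 0) l j n).1 (slots (k 0) (l 0) l j n).2 (frameH G ℓ f k l n)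

variable {s : ℕ} {G : ℕ → MvPolynomial (Fin 3) K} {j : ℕ → Fin 3} {b : ℕ → Fin 3 → K} {k l f : ℕ → Fin 3} {c : ℕ → K}
  {ℓ : ℕ → MvPolynomial (Fin 3) K}

section Stage

variable (hkl : ∀ n, k n ≠ l n) (hfk : ∀ n, f n ≠ k n) (hfl : ∀ n, f n ≠ l n)
  (hordG : ∀ n, ordZero (G n) = s) (hc : ∀ n, c n ≠ 0) (hℓ : ∀ n, (ℓ n).IsHomogeneous 1)
  (hin : ∀ n, homogeneousComponent s (G n) = C (c n) * ℓ n ^ s)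
  (htr : ∀ n, coeff (Finsupp.single (f n) 1) (ℓ n) ≠ 0) (hiso : ∀ n, NearCut.IsolatedMult s (G n))
  (hwalls : ∀ n, (k (n + 1) = k n ∧ l (n + 1) = j n) ∨ (k (n + 1) = j n ∧ l (n + 1) = k n))

include hkl hfk hfl hℓ hin htr in
/-- Law L2: the frame polynomial `H_n` has pure tangent form `c_n ℓ_{n,f}^s · y_{f_n}^s`. [new] -/
theorem frameH_in (n : ℕ) : homogeneousComponent s (frameH G ℓ f k l n) =
    C (c n * coeff (Finsupp.single (f n) 1) (ℓ n) ^ s) * X (f n) ^ s :=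
  frame_in (hfk n) (hfl n) (hkl n) (hℓ n) (hin n) (htr n)

include hc htr in
/-- The leading coefficient `c_n ℓ_{n,f}^s` of the frame polynomial is nonzero (transversality). [new] -/
theorem frameH_c_ne (n : ℕ) : c n * coeff (Finsupp.single (f n) 1) (ℓ n) ^ s ≠ 0 :=
  mul_ne_zero (hc n) (pow_ne_zero _ (htr n))

/-- Negating a two-term linear form negates its coefficients (bookkeeping for the inverse shear). [folklore] -/
theorem neg_lin (u v : Fin 3) (a b' : K) :
    (-(C a * X u + C b' * X v) : MvPolynomial (Fin 3) K) = C (-a) * X u + C (-b') * X v := by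
  rw [map_neg, map_neg]; ring

include hfk hfl hordG in
/-- Law L2: the frame polynomial `H_n` has order exactly `s` (the shear preserves the order). [new] -/
theorem frameH_ord (n : ℕ) : ordZero (frameH G ℓ f k l n) = s := by
  unfold frameH
  rw [neg_lin, WallFrames.ordZero_zshear (varFree_lin (hfk n).symm (hfl n).symm _ _) (one_le_ordZero_lin _ _ _ _), hordG]

include hfk hfl in
/-- Law L2 (inverse frame): `G_n` is recovered from the frame polynomial `H_n` by the shear `y_f ↦ y_f + (ℓ_k/ℓ_f) y_k + (ℓ_l/ℓ_f) y_l`. [new] -/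
theorem G_eq_zshear_frameH (n : ℕ) : G n = WallFrames.zshear (f n)
    (C (coeff (Finsupp.single (k n) 1) (ℓ n) / coeff (Finsupp.single (f n) 1) (ℓ n)) * X (k n) +
      C (coeff (Finsupp.single (l n) 1) (ℓ n) / coeff (Finsupp.single (f n) 1) (ℓ n)) * X (l n)) (frameH G ℓ f k l n) := by
  unfold frameH
  rw [WallFrames.zshear_zshear_neg (varFree_lin (hfk n).symm (hfl n).symm _ _)]

include hkl hwalls in
/-- **L1 · SLOT INVARIANT:** the two slots always hold the two wall letters. [new] -/
theorem slots_spec (n : ℕ) :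
    ((slots (k 0) (l 0) l j n).1 = k n ∧ (slots (k 0) (l 0) l j n).2 = l n) ∨
      ((slots (k 0) (l 0) l j n).1 = l n ∧ (slots (k 0) (l 0) l j n).2 = k n) := by
  induction n with
  | zero => exact Or.inl ⟨rfl, rfl⟩
  | succ n ih =>
    rw [slots_succ]
    rcases ih with ⟨hu, hv⟩ | ⟨hu, hv⟩
    · rw [if_neg (by rw [hu]; exact hkl n), hu]
      rcases hwalls n with ⟨hk', hl'⟩ | ⟨hk', hl'⟩
      · exact Or.inl ⟨hk'.symm, hl'.symm⟩
      · exact Or.inr ⟨hl'.symm, hk'.symm⟩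
    · rw [if_pos hu, hv]
      rcases hwalls n with ⟨hk', hl'⟩ | ⟨hk', hl'⟩
      · exact Or.inr ⟨hl'.symm, hk'.symm⟩
      · exact Or.inl ⟨hk'.symm, hl'.symm⟩

include hkl hfk hfl hiso in
/-- **L5 · ISOLATION LAW along the chain:** `Δ_n` has a point with first coordinate `< 1` and one with second
coordinate `< 1`; in particular it is nonempty and `α_n ≤ 1 − 1/s`. [new] -/
theorem framePts_exists_lt_one (hwalls : ∀ n, (k (n + 1) = k n ∧ l (n + 1) = j n) ∨ (k (n + 1) = j n ∧ l (n + 1) = k n))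
    (n : ℕ) : (∃ x ∈ framePts s G ℓ f k l j n, x.1 < 1) ∧ (∃ x ∈ framePts s G ℓ f k l j n, x.2 < 1) := by
  have hG := G_eq_zshear_frameH hfk hfl (G := G) (ℓ := ℓ) (k := k) (l := l) n
  have hisoN := hiso n
  unfold framePts
  rcases slots_spec hkl hwalls n with ⟨hu, hv⟩ | ⟨hu, hv⟩
  · rw [hu, hv]
    rw [hG] at hisoN
    exact ⟨exists_fst_lt_one (hkl n) (hfk n).symm (hfl n).symm _ _ hisoN,
      exists_snd_lt_one (hkl n) (hfk n).symm (hfl n).symm _ _ hisoN⟩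
  · rw [hu, hv]
    rw [hG, add_comm] at hisoN
    exact ⟨exists_fst_lt_one (hkl n).symm (hfl n).symm (hfk n).symm _ _ hisoN,
      exists_snd_lt_one (hkl n).symm (hfl n).symm (hfk n).symm _ _ hisoN⟩

include hkl hfk hfl hiso in
/-- Law L5 (consequence): the frame point set `Δ_n` is nonempty along an isolated chain. [new] -/
theorem framePts_nonempty (hwalls : ∀ n, (k (n + 1) = k n ∧ l (n + 1) = j n) ∨ (k (n + 1) = j n ∧ l (n + 1) = k n))
    (n : ℕ) : (framePts s G ℓ f k l j n).Nonempty := by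
  obtain ⟨⟨x, hx, _⟩, _⟩ := framePts_exists_lt_one hkl hfk hfl hiso hwalls n
  exact ⟨x, hx⟩

include hkl hfk hfl hiso in
/-- Law L5 (ISOLATION LAW): along an isolated chain `α_n ≤ 1 − 1/s`; Cossart–Jannsen–Saito 2020, Lemma 12.1 (there via well-preparedness, here via `IsolatedMult`). [cite: CossartJannsenSaito2020, Lemma 12.1 p.133] -/
theorem alpha_le (hwalls : ∀ n, (k (n + 1) = k n ∧ l (n + 1) = j n) ∨ (k (n + 1) = j n ∧ l (n + 1) = k n))
    (n : ℕ) : (lexMin (framePts s G ℓ f k l j n)).1 ≤ 1 - 1 / (s : ℚ) := by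
  obtain ⟨⟨x, hx, hx1⟩, _⟩ := framePts_exists_lt_one hkl hfk hfl hiso hwalls n
  have hne : (framePts s G ℓ f k l j n).Nonempty := ⟨x, hx⟩
  have hmem := lexMin_mem hne
  unfold framePts at hmem hx ⊢
  exact fst_le_of_lt_one hmem (lt_of_le_of_lt (lexMin_fst_le hx) hx1)

/-- `β_n ≥ 0`: ordinates of frame points are nonnegative. [folklore] -/
theorem beta_nonneg (n : ℕ) (hne : (framePts s G ℓ f k l j n).Nonempty) : 0 ≤ (lexMin (framePts s G ℓ f k l j n)).2 := by
  have hmem := lexMin_mem hne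
  unfold framePts at hmem ⊢
  exact (nonneg_of_mem_pts hmem).2

end Stage

end Chain

end Summit.ResolutionOfSingularities.ResolutionOfSingularities.Theorems.WildDescent
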